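import Literature.Probability.LatticeModels.NoPlusPercolation
import HarnessLib

/-!
# Enclosure by the exploration volume when no passable cluster percolates

Topic `Probability/LatticeModels`; theorems only. The step "each finite `Δ` is almost surely
surrounded …, and with probability close to `1` such a circuit can already be found within a
square `Λ ⊃ Δ` provided `Λ` is large enough" of Georgii–Higuchi 2000 (proofs of Lemmas 2.1, 2.2,
3.1 and Prop. 5.1), in the circuit-free form of `ExplorationVolume` and for an **arbitrary
passable-set map** `T : Ω → Set ℤ^d` (for `T = S⁺` this is `NoPlusPercolation`; Lemma 2.2 and the
butterfly lemma use the bad sites `{ω = ω∘R = -1}`, Prop. 5.1 the sites of disagreement of two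
layers):

* `iInter_not_subset_explVolume_subset_of` — a configuration with `Δ ⊄ Γ_n(ω)` for all `n`
  (`Γ_n(ω) = explVolume 𝕃^d B(n) (T ω)`) has an infinite `T ω`-cluster at a site of `Δ` or next
  to it;
* `tendsto_measure_not_subset_explVolume_of` — hence if `μ`-almost surely no `T ω`-cluster at any
  site is infinite (and the events `{Δ ⊆ Γ_n}` are measurable), `μ(Δ ⊄ Γ_n) → 0`.

## References

* H.-O. Georgii, Y. Higuchi, J. Math. Phys. 41 (2000) 1153–1169, proofs of Lemma 2.1 (pp. 4–5),
  Lemma 2.2 (p. 5), Prop. 5.1 (p. 16) [GeorgiiHiguchi2000].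
-/

noncomputable section

open MeasureTheory Filter Topology Finset
open Literature.Probability.Percolation (siteCluster sitePercolatesAt siteOpenGraph siteOpenGraph_mono)

namespace Literature.Probability.LatticeModels

variable {d : ℕ} {Ω : Type*}

/-- The events `{Δ ⊆ explVolume B(n) (T ω)}` increase with `n`. [cite: GeorgiiHiguchi2000, Lemma 2.1 (proof, pp. 4–5)] -/
theorem monotone_subset_explVolume_of (T : Ω → Set (Site d)) (Δ : Finset (Site d)) :
    Monotone fun n => {ω : Ω | Δ ⊆ explVolume (zdGraph d) (box d n) (T ω)} :=
  fun _ _ hnm _ hω => hω.trans (explVolume_mono_volume (box_mono d hnm) _)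

/-- **If no passable cluster near `Δ` is infinite, `Δ` is eventually enclosed** (the step of
Georgii–Higuchi 2000 quoted in the module docstring, for a general passable-set map `T`): a
configuration with `Δ ⊄ explVolume B(n) (T ω)` for every `n` has an infinite `T ω`-cluster at a
site of `Δ` or adjacent to `Δ` (as in `iInter_not_subset_explVolume_subset`). [cite: GeorgiiHiguchi2000, Lemma 2.1 (proof, pp. 4–5)] -/
theorem iInter_not_subset_explVolume_subset_of (T : Ω → Set (Site d)) (Δ : Finset (Site d)) :
    (⋂ n, {ω : Ω | Δ ⊆ explVolume (zdGraph d) (box d n) (T ω)}ᶜ) ⊆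
      ⋃ t ∈ Δ ∪ Δ.biUnion (fun y => (zdGraph d).neighborFinset y),
        {ω | T ω ∈ sitePercolatesAt (zdGraph d) t} := by
  intro ω hω
  simp only [Set.mem_iInter, Set.mem_compl_iff, Set.mem_setOf_eq] at hω
  set K : Finset (Site d) := Δ ∪ Δ.biUnion (fun y => (zdGraph d).neighborFinset y) with hK
  obtain ⟨n₀, hn₀⟩ := (eventually_subset_box_holds (d := d) K).exists_forall_of_atTop
  have hy : ∃ y ∈ Δ, ∀ n, n₀ ≤ n → y ∉ explVolume (zdGraph d) (box d n) (T ω) := by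
    by_contra hall
    push Not at hall
    choose! N hN hNmem using hall
    have hsub : Δ ⊆ explVolume (zdGraph d) (box d (Δ.sup N + n₀)) (T ω) := by
      intro y hyΔ
      exact explVolume_mono_volume (box_mono d ((Finset.le_sup hyΔ).trans (Nat.le_add_right _ _)))
        _ (hNmem y hyΔ)
    exact hω _ hsub
  obtain ⟨y, hyΔ, hy⟩ := hy
  have hyK : y ∈ K := Finset.mem_union_left _ hyΔ
  have hstep : ∀ n, n₀ ≤ n → ∃ t ∈ (zdGraph d).neighborFinset y,
      ∃ t' ∈ siteCluster (zdGraph d) (T ω) t, t' ∈ innerBoundary (zdGraph d) (box d n) := by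
    intro n hn
    have hyΛ : y ∈ box d n := hn₀ n hn hyK
    have hfar : ∀ z, (zdGraph d).Adj y z → z ∈ box d n := fun z hz =>
      hn₀ n hn (Finset.mem_union_right _ (Finset.mem_biUnion.2 ⟨y, hyΔ,
        (SimpleGraph.mem_neighborFinset _ _ _).2 hz⟩))
    obtain ⟨t, t', ht, -, hadj, ht', ht'b, hreach⟩ :=
      exists_reachable_innerBoundary_of_not_mem_explVolume hyΛ (hy n hn) hfar
    refine ⟨t, (SimpleGraph.mem_neighborFinset _ _ _).2 hadj, t', ⟨ht, ht', ?_⟩, ht'b⟩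
    exact hreach.mono (siteOpenGraph_mono (zdGraph d) Set.inter_subset_left)
  have hfreq : ∃ t ∈ (zdGraph d).neighborFinset y, ∃ᶠ n in atTop,
      ∃ t' ∈ siteCluster (zdGraph d) (T ω) t, t' ∈ innerBoundary (zdGraph d) (box d n) := by
    by_contra hnone
    push Not at hnone
    have hfin : ∀ᶠ n in atTop, ∀ t ∈ (zdGraph d).neighborFinset y,
        ¬ ∃ t' ∈ siteCluster (zdGraph d) (T ω) t, t' ∈ innerBoundary (zdGraph d) (box d n) := by
      rw [eventually_all_finset]
      intro t ht
      filter_upwards [hnone t ht] with n hn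
      push Not
      exact hn
    obtain ⟨n, hn, hn'⟩ := (hfin.and (eventually_ge_atTop n₀)).exists
    obtain ⟨t, ht, ht'⟩ := hstep n hn'
    exact hn t ht ht'
  obtain ⟨t, ht, hfr⟩ := hfreq
  refine Set.mem_iUnion₂.2 ⟨t, Finset.mem_union_right _ (Finset.mem_biUnion.2 ⟨y, hyΔ, ht⟩), ?_⟩
  exact Set.infinite_of_frequently_mem_innerBoundary_box hfr

/-- **Enclosure in probability** (Georgii–Higuchi 2000, the step quoted in the module docstring):
if the events `{Δ ⊆ Γ_n}` are measurable and `μ`-almost surely no `T ω`-cluster is infinite, then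
`μ(Δ ⊄ Γ_n) → 0`. [cite: GeorgiiHiguchi2000, Lemma 2.2 (p. 5)] -/
theorem tendsto_measure_not_subset_explVolume_of [MeasurableSpace Ω] (μ : Measure Ω)
    [IsFiniteMeasure μ] (T : Ω → Set (Site d)) (Δ : Finset (Site d))
    (hmeas : ∀ n, MeasurableSet {ω : Ω | Δ ⊆ explVolume (zdGraph d) (box d n) (T ω)})
    (hnull : ∀ t : Site d, μ {ω | T ω ∈ sitePercolatesAt (zdGraph d) t} = 0) :
    Tendsto (fun n => μ {ω : Ω | Δ ⊆ explVolume (zdGraph d) (box d n) (T ω)}ᶜ) atTop (𝓝 0) := by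
  have hanti : Antitone fun n => {ω : Ω | Δ ⊆ explVolume (zdGraph d) (box d n) (T ω)}ᶜ :=
    fun n m hnm => Set.compl_subset_compl.2 (monotone_subset_explVolume_of T Δ hnm)
  have hnull' : μ (⋂ n, {ω : Ω | Δ ⊆ explVolume (zdGraph d) (box d n) (T ω)}ᶜ) = 0 := by
    refine measure_mono_null (iInter_not_subset_explVolume_subset_of T Δ) ?_
    exact (measure_biUnion_null_iff (Finset.countable_toSet _)).2 fun t _ => hnull t
  have h := tendsto_measure_iInter_atTop (μ := μ)
    (fun n => (hmeas n).compl.nullMeasurableSet) hanti ⟨0, measure_ne_top _ _⟩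
  rwa [hnull'] at h

end Literature.Probability.LatticeModels
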